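import Literature.Analysis.FluidPDE.BoundedMildSmoothRemainder
import Literature.Analysis.FluidPDE.ForcedOseenRepresentationClassical
import Literature.Analysis.FluidPDE.NSBoundedMildSmoothing
import HarnessLib

/-!
# Uniform derivative bounds for BOUNDED classical finite-energy Navier–Stokes solutions
# (KNSS 2009, Prop. 4.1 / (4.10), fed with a classical solution), and Landau's interpolation
# inequality for the gradient

Analysis/FluidPDE proof file (theorems only; no definitions, no named facts, no `sorry`).

Koch–Nadirashvili–Seregin–Šverák, Acta Math. 203 (2009) = arXiv:0709.3599v1, §4, (4.10):
"`‖∇ᵏₓu‖_{L^∞(ℝⁿ×(δ,T))} ≤ C(k, δ, T, M)`" for a bounded mild solution `‖u‖ ≤ M` on `(0, T)`. The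
tree holds this with the constants chosen BEFORE the solution (`KNSS2009_mild_regularity`,
PROVED: `KNSS2009_mild_regularity_holds`) for restarted bounded mild fields
(`IsKNSSDriftMild T N V 0`). This file feeds it with a CLASSICAL solution:

* `IsClassicalNSSolutionOn.eq_heatExtension_sub_oseenDuhamel_of_bounded` — a bounded classical
  finite-energy solution of the unforced system on `[0, S] × ℝ³` (`ν = 1`) satisfies the mild
  identity restarted at ANY time, pointwise: `u(t) = e^{(t−s)Δ}u(s) − B¹ₛ(u,u)(t)`, `0 ≤ s < t ≤ S`
  (the a.e. Oseen representation of the translate, `IsClassicalNSSolutionOn.ae_eq_forced_oseenMild`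
  with zero force, and continuity of both sides);
* `IsClassicalNSSolutionOn.isKNSSDriftMild_clamp_of_bounded` — hence its time-clamp is a restarted
  bounded mild field in the sense of KNSS (`isKNSSDriftMild_clamp_of_oseenForward`);
* `exists_uniform_iteratedFDeriv_bound_of_bounded_classical` — **KNSS (4.10) for classical
  solutions, constants first**: for all `N`, `S > 0` there is `C : ℕ → ℝ → ℝ` such that EVERY unforced
  classical finite-energy solution on `[0, S] × ℝ³` with `‖u‖ ≤ N` obeys
  `‖∇ᵏu(t, x)‖ ≤ C k δ` for `t ∈ (δ, S)`, all `x`, all `k`, `δ > 0`;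
* `norm_fderiv_le_of_norm_le_of_norm_iteratedFDeriv_two_le` — **Landau's inequality** on a real
  normed space: `‖f‖ ≤ δ₀` and `‖D²f‖ ≤ K` everywhere give `‖Df(x)‖ ≤ 2δ₀/h + K h` for every `h > 0`
  (Taylor along segments; Landau 1913 / Kolmogorov; Hardy–Littlewood–Pólya, Thm. 8.1 mechanism).

Consumer: the FREE-RUN DOOR of the cell `ns-blowup` (crux `EpisodeBase`,
stmt-NavierStokesRegularity-19179): the gradient of a perturbed run at the read-out time is within
`O(√(sup‖ũ − u‖))` of the gradient of the free run, the second derivatives of both being bounded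
uniformly by (4.10). LABEL: Literature port. WHAT THIS IS NOT: not a regularity or blow-up claim —
bounds for GIVEN bounded classical solutions on a fixed slab.

## Mathlib / tree search

Tree: `KNSS2009_mild_regularity_holds` (`KNSSLiouvillePlanarHolds`), `isKNSSDriftMild_clamp_of_oseenForward`
(`BoundedMildSmoothRemainder`), `IsClassicalNSSolutionOn.ae_eq_forced_oseenMild`
(`ForcedOseenRepresentationClassical`), `oseenDuhamel_translate`, `continuous_oseenDuhamel_slice`
(`NSBoundedMildSmoothing`), `UnboundedOperators.contDiff_heatExtension_holds`. The Tao-class twin is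
`IsTaoSolutionOn.isKNSSDriftMild_clamp` (`TaoQuantitativeKNSSBridge`), which needs `∂ₜu`, `p` in
`L^∞_t H^k_x` and `C_t L²`; here only boundedness and finite energy are used. Mathlib:
`norm_image_sub_le_of_norm_deriv_le_segment'`, `Convex.norm_image_sub_le_of_norm_fderiv_le`,
`ContinuousLinearMap.opNorm_le_of_unit_norm`, `norm_iteratedFDeriv_fderiv`; no Landau–Kolmogorov
inequality (`lean search 'Landau|Kolmogorov.*inequality'`).

## References

* G. Koch, N. Nadirashvili, G. Seregin, V. Šverák, *Liouville theorems for the Navier–Stokes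
  equations and applications*, Acta Math. 203 (2009) 83–105 = arXiv:0709.3599v1, §4, Prop. 4.1,
  (4.6), (4.10). [KochNadirashviliSereginSverak2009]
* G. H. Hardy, J. E. Littlewood, G. Pólya, *Inequalities*, 2nd ed., CUP 1952, §8 (Landau's
  inequality `‖f'‖² ≤ 4‖f‖‖f''‖`). [HardyLittlewoodPolya1952]
* P. G. Lemarié-Rieusset, *The Navier–Stokes Problem in the 21st Century*, CRC 2016, Thm. 6.1 (6.12).
  [LemarieRieusset2016]
-/

noncomputable section

open MeasureTheory Set Function Filter
open _root_.Topology
open scoped ENNReal NNReal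

namespace Literature.Analysis.FluidPDE

/-! ### The restarted mild identity of a bounded classical solution, pointwise -/

section Restart

variable {S N : ℝ} {u : ℝ → EuclideanSpace ℝ (Fin 3) → EuclideanSpace ℝ (Fin 3)}
  {p : ℝ → EuclideanSpace ℝ (Fin 3) → ℝ}

/-- **The mild identity restarted at any time, pointwise, for a bounded classical finite-energy
solution of the unforced system** (`ν = 1`): for `0 ≤ s < t ≤ S` and every `x`,
`u(t, x) = e^{(t−s)Δ}u(s)(x) − B¹ₛ(u, u)(t)(x)`. The translate `u(· + s)` is a bounded classical
finite-energy solution on `[0, S − s]`, so its Oseen representation holds a.e.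
(`IsClassicalNSSolutionOn.ae_eq_forced_oseenMild`, zero force); both sides are continuous in `x`.
[cite: LemarieRieusset2016, Thm. 6.1 (6.12) with Prop. 6.5]
[cite: KochNadirashviliSereginSverak2009, §4 (i) (arXiv:0709.3599v1 p. 8)] -/
theorem IsClassicalNSSolutionOn.eq_heatExtension_sub_oseenDuhamel_of_bounded
    (hu : IsClassicalNSSolutionOn (Icc 0 S) 1 0 u p)
    (hE : ∃ C : ℝ≥0∞, C < ⊤ ∧ ∀ t ∈ Icc 0 S, ∫⁻ x, ‖u t x‖ₑ ^ 2 ≤ C)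
    (hN : 0 < N) (hbd : ∀ t ∈ Icc 0 S, ∀ x, ‖u t x‖ ≤ N)
    {s t : ℝ} (hs : 0 ≤ s) (hst : s < t) (htS : t ≤ S) (x : EuclideanSpace ℝ (Fin 3)) :
    u t x = UnboundedOperators.heatExtension (u s) (t - s) x - oseenDuhamel 1 s u u t x := by
  have hsS : s < S := hst.trans_le htS
  have hSs : 0 < S - s := sub_pos.2 hsS
  -- ### the translate by `s`
  have hτ : IsClassicalNSSolutionOn (Icc 0 (S - s)) 1 0 (fun r => u (r + s)) (fun r => p (r + s)) :=
    (hu.comp_add_right s).mono (fun r hr => ⟨by linarith [hr.1], by linarith [hr.2]⟩)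
      (uniqueDiffOn_Icc hSs)
  have hEτ : ∃ C : ℝ≥0∞, C < ⊤ ∧ ∀ r ∈ Icc 0 (S - s), ∫⁻ x, ‖u (r + s) x‖ₑ ^ 2 ≤ C := by
    obtain ⟨C, hC, hb⟩ := hE
    exact ⟨C, hC, fun r hr => hb (r + s) ⟨by linarith [hr.1], by linarith [hr.2]⟩⟩
  have hbdτ : ∀ r ∈ Icc 0 (S - s), ∀ y, ‖u (r + s) y‖ ≤ N := fun r hr y =>
    hbd (r + s) ⟨by linarith [hr.1], by linarith [hr.2]⟩ y
  -- ### the representation of the translate at time `t - s` (zero force)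
  have hgc : Continuous (uncurry (0 : ℝ → EuclideanSpace ℝ (Fin 3) → EuclideanSpace ℝ (Fin 3))) :=
    continuous_const
  have hG : ∀ τ ∈ Icc 0 (S - s), ∀ y,
      ‖(0 : ℝ → EuclideanSpace ℝ (Fin 3) → EuclideanSpace ℝ (Fin 3)) τ y‖ ≤ 0 := fun τ _ y => by simp
  have hgdiv : ∀ τ ∈ Icc 0 (S - s),
      IsWeaklyDivFree ((0 : ℝ → EuclideanSpace ℝ (Fin 3) → EuclideanSpace ℝ (Fin 3)) τ) :=
    fun τ _ θ _ => by simp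
  have hg2 : ∀ τ ∈ Icc 0 (S - s),
      eLpNorm ((0 : ℝ → EuclideanSpace ℝ (Fin 3) → EuclideanSpace ℝ (Fin 3)) τ) 2 volume ≤ (0 : ℝ≥0∞) :=
    fun τ _ => by simp
  have hrep := hτ.ae_eq_forced_oseenMild one_pos hSs hgc hG hgdiv ENNReal.zero_ne_top hg2 hEτ hN hbdτ
    (t := t - s) ⟨sub_pos.2 hst, by linarith⟩
  -- ### simplify: zero force, time translation of the Duhamel term
  have h0 : ∀ y, forceDuhamel 1 0 (0 : ℝ → EuclideanSpace ℝ (Fin 3) → EuclideanSpace ℝ (Fin 3))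
      (t - s) y = 0 := by
    intro y
    rw [forceDuhamel_apply]
    have hz : ∀ τ, UnboundedOperators.heatExtension
        ((0 : ℝ → EuclideanSpace ℝ (Fin 3) → EuclideanSpace ℝ (Fin 3)) τ) (1 * (t - s - τ)) y = 0 := by
      intro τ
      have : ((0 : ℝ → EuclideanSpace ℝ (Fin 3) → EuclideanSpace ℝ (Fin 3)) τ) =
          fun _ : EuclideanSpace ℝ (Fin 3) => (0 : EuclideanSpace ℝ (Fin 3)) := rfl
      rw [this, UnboundedOperators.heatExtension_zero_fun]; rfl
    simp_rw [hz, integral_zero]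
  have htr : ∀ y, oseenDuhamel 1 0 (fun r => u (r + s)) (fun r => u (r + s)) (t - s) y =
      oseenDuhamel 1 s u u t y := fun y => by
    rw [oseenDuhamel_translate, zero_add, sub_add_cancel]
  have hae : u t =ᵐ[volume] fun y =>
      UnboundedOperators.heatExtension (u s) (t - s) y - oseenDuhamel 1 s u u t y := by
    have h1 : (fun r => u (r + s)) (t - s) = u t := by simp only [sub_add_cancel]
    rw [← h1]
    filter_upwards [hrep] with y hy
    rw [hy, h0 y, add_zero, htr y, one_mul]
    simp only [zero_add]
  -- ### both sides are continuous
  have huc : Continuous (u t) := (hu.contDiff_velocity ⟨hs.trans hst.le, htS⟩).continuous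
  have husc : Continuous (u s) := (hu.contDiff_velocity ⟨hs, hsS.le⟩).continuous
  have hHc : Continuous (UnboundedOperators.heatExtension (u s) (t - s)) :=
    (UnboundedOperators.contDiff_heatExtension_holds
      (UnboundedOperators.memLp_top_of_continuous_of_bound husc (hbd s ⟨hs, hsS.le⟩)) le_top
      (sub_pos.2 hst)).continuous
  have hum : AEStronglyMeasurable (uncurry u)
      ((volume : Measure (ℝ × EuclideanSpace ℝ (Fin 3))).restrict (Ioo s S ×ˢ univ)) :=
    (hu.smooth_velocity.continuousOn.mono
      (prod_mono (fun r hr => ⟨hs.trans hr.1.le, hr.2.le⟩) Subset.rfl)).aestronglyMeasurable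
      (measurableSet_Ioo.prod MeasurableSet.univ)
  have hbd' : ∀ τ ∈ Ioo s S, ∀ y, ‖u τ y‖ ≤ N := fun τ hτ y => hbd τ ⟨hs.trans hτ.1.le, hτ.2.le⟩ y
  have hBc : Continuous (oseenDuhamel 1 s u u t) :=
    continuous_oseenDuhamel_slice one_pos hN.le hum hum hbd' hbd' hst htS
  have heq := (Continuous.ae_eq_iff_eq volume huc (hHc.sub hBc)).1 hae
  exact congrFun heq x

/-- **A bounded classical finite-energy solution of the unforced system, time-clamped to `[0, S]`,
is a restarted bounded mild field in the sense of KNSS 2009, §4 (i)**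
(`IsKNSSDriftMild S N V 0`, `V t = u (max 0 (min t S))`). [cite: KochNadirashviliSereginSverak2009, §4 (i) with (4.3)–(4.4) (arXiv:0709.3599v1 p. 8)] -/
theorem IsClassicalNSSolutionOn.isKNSSDriftMild_clamp_of_bounded
    (hu : IsClassicalNSSolutionOn (Icc 0 S) 1 0 u p) (hS : 0 < S)
    (hE : ∃ C : ℝ≥0∞, C < ⊤ ∧ ∀ t ∈ Icc 0 S, ∫⁻ x, ‖u t x‖ₑ ^ 2 ≤ C)
    (hN : 0 < N) (hbd : ∀ t ∈ Icc 0 S, ∀ x, ‖u t x‖ ≤ N) :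
    IsKNSSDriftMild S N (fun t x => u (max 0 (min t S)) x) 0 :=
  isKNSSDriftMild_clamp_of_oseenForward hS hu.smooth_velocity.continuousOn hbd
    (fun t ht => VectorCalculus.IsDivFree.isWeaklyDivFree_holds (hu.divFree t ht)
      ((hu.contDiff_velocity ht).of_le (by norm_cast)))
    (fun s t hs hst htS x => hu.eq_heatExtension_sub_oseenDuhamel_of_bounded hE hN hbd hs hst htS x)

end Restart

/-! ### KNSS (4.10) for bounded classical solutions, constants first -/

/-- **KNSS 2009, (4.10), for bounded classical finite-energy solutions — constants chosen before the
solution.** For all `N` and `S > 0` there is `C : ℕ → ℝ → ℝ` such that every classical solution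
`(u, p)` of the UNFORCED Navier–Stokes system (`ν = 1`) on `[0, S] × ℝ³` with finite energy and
`‖u‖ ≤ N` (`N > 0`) satisfies `‖∇ᵏu(t, x)‖ ≤ C k δ` for all `k`, `δ > 0`, `t ∈ (δ, S)` and `x`.
[cite: KochNadirashviliSereginSverak2009, Prop. 4.1 with (4.6) and §4 (4.10) (arXiv:0709.3599v1 p. 8)] -/
theorem exists_uniform_iteratedFDeriv_bound_of_bounded_classical (N S : ℝ) (hS : 0 < S) :
    ∃ C : ℕ → ℝ → ℝ, ∀ {u : ℝ → EuclideanSpace ℝ (Fin 3) → EuclideanSpace ℝ (Fin 3)}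
      {p : ℝ → EuclideanSpace ℝ (Fin 3) → ℝ},
      IsClassicalNSSolutionOn (Icc 0 S) 1 0 u p →
      (∃ C : ℝ≥0∞, C < ⊤ ∧ ∀ t ∈ Icc 0 S, ∫⁻ x, ‖u t x‖ₑ ^ 2 ≤ C) →
      0 < N → (∀ t ∈ Icc 0 S, ∀ x, ‖u t x‖ ≤ N) →
      ∀ δ : ℝ, 0 < δ → ∀ k : ℕ, ∀ t ∈ Ioo δ S, ∀ x, ‖iteratedFDeriv ℝ k (u t) x‖ ≤ C k δ := by
  obtain ⟨C, L, hCL⟩ := KNSS2009_mild_regularity_holds N S hS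
  refine ⟨C, fun {u p} hu hE hN hbd δ hδ k t ht x => ?_⟩
  have hV := hu.isKNSSDriftMild_clamp_of_bounded hS hE hN hbd
  have h := (hCL hV).2.2.1 δ hδ k t ht x
  have hid : max 0 (min t S) = t := by
    rw [min_eq_left ht.2.le, max_eq_right (hδ.le.trans ht.1.le)]
  have hfun : (fun y => u (max 0 (min t S)) y) = u t := by
    funext y; rw [hid]
  rwa [hfun] at h

/-! ### Landau's interpolation inequality for the gradient -/

section Landau

variable {E F : Type*} [NormedAddCommGroup E] [NormedSpace ℝ E] [NormedAddCommGroup F]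
  [NormedSpace ℝ F]

/-- **Landau's inequality (sup-norm form, on a real normed space).** If `f : E → F` is `C²` with
`‖f(z)‖ ≤ δ₀` and `‖D²f(z)‖ ≤ K` for all `z`, then for every `h > 0` and every `x`,
`‖Df(x)‖ ≤ 2δ₀/h + K h` (optimising `h` gives `‖Df‖ ≤ 2√2 (δ₀K)^{1/2}`). Proof: for a unit vector
`e`, Taylor along the segment `s ↦ x + s e`: `‖f(x + he) − f(x) − h Df(x)e‖ ≤ K h²`, since
`‖Df(x + se) − Df(x)‖ ≤ K s`. [cite: HardyLittlewoodPolya1952, §8 (Landau's inequality)] -/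
theorem norm_fderiv_le_of_norm_le_of_norm_iteratedFDeriv_two_le {f : E → F} (hf : ContDiff ℝ 2 f)
    {δ₀ K : ℝ} (h0 : ∀ z, ‖f z‖ ≤ δ₀) (h2 : ∀ z, ‖iteratedFDeriv ℝ 2 f z‖ ≤ K)
    {h : ℝ} (hh : 0 < h) (x : E) : ‖fderiv ℝ f x‖ ≤ 2 * δ₀ / h + K * h := by
  have hδ₀ : 0 ≤ δ₀ := (norm_nonneg _).trans (h0 x)
  have hK : 0 ≤ K := (norm_nonneg _).trans (h2 x)
  -- differentiability of `f` and of `Df`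
  have hf1 : Differentiable ℝ f := hf.differentiable (by norm_num)
  have hdf : Differentiable ℝ (fderiv ℝ f) := by
    have h' : ContDiff ℝ 1 (fderiv ℝ f) := hf.fderiv_right (by norm_num)
    exact h'.differentiable (by norm_num)
  -- `‖D(Df)(z)‖ ≤ K`
  have h2' : ∀ z, ‖fderiv ℝ (fderiv ℝ f) z‖ ≤ K := by
    intro z
    have := h2 z
    rwa [← norm_iteratedFDeriv_fderiv, norm_iteratedFDeriv_one] at this
  -- the Lipschitz bound of `Df`
  have hLip : ∀ y z, ‖fderiv ℝ f y - fderiv ℝ f z‖ ≤ K * ‖y - z‖ := fun y z =>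
    Convex.norm_image_sub_le_of_norm_fderiv_le (f := fderiv ℝ f) (fun w _ => hdf w)
      (fun w _ => h2' w) convex_univ (mem_univ z) (mem_univ y)
  -- the bound on unit vectors
  have hunit : ∀ e : E, ‖e‖ = 1 → ‖fderiv ℝ f x e‖ ≤ 2 * δ₀ / h + K * h := by
    intro e he
    -- the Taylor remainder along the segment `s ↦ x + s • e`
    set φ : ℝ → F := fun s => f (x + s • e) - s • fderiv ℝ f x e with hφ
    have hφd : ∀ s, HasDerivAt φ (fderiv ℝ f (x + s • e) e - fderiv ℝ f x e) s := by
      intro s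
      have hγ : HasDerivAt (fun s : ℝ => x + s • e) e s := by
        simpa using ((hasDerivAt_id s).smul_const e).const_add x
      have h1 : HasDerivAt (fun s : ℝ => f (x + s • e)) (fderiv ℝ f (x + s • e) e) s :=
        (hf1 (x + s • e)).hasFDerivAt.comp_hasDerivAt s hγ
      have h2 : HasDerivAt (fun s : ℝ => s • fderiv ℝ f x e) (fderiv ℝ f x e) s := by
        simpa using (hasDerivAt_id s).smul_const (fderiv ℝ f x e)
      exact h1.sub h2
    have hbound : ∀ s ∈ Ico (0 : ℝ) h, ‖fderiv ℝ f (x + s • e) e - fderiv ℝ f x e‖ ≤ K * h := by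
      intro s hs
      calc ‖fderiv ℝ f (x + s • e) e - fderiv ℝ f x e‖
          = ‖(fderiv ℝ f (x + s • e) - fderiv ℝ f x) e‖ := by
            rw [sub_apply]
        _ ≤ ‖fderiv ℝ f (x + s • e) - fderiv ℝ f x‖ * ‖e‖ := ContinuousLinearMap.le_opNorm _ _
        _ ≤ K * ‖x + s • e - x‖ * ‖e‖ :=
            mul_le_mul_of_nonneg_right (hLip _ _) (norm_nonneg _)
        _ = K * s := by
            rw [add_sub_cancel_left, norm_smul, he, mul_one, mul_one, Real.norm_of_nonneg hs.1]
        _ ≤ K * h := mul_le_mul_of_nonneg_left hs.2.le hK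
    have hMVT := norm_image_sub_le_of_norm_deriv_le_segment' (f := φ)
      (fun s _ => (hφd s).hasDerivWithinAt) hbound h ⟨hh.le, le_rfl⟩
    -- `φ h - φ 0 = f (x + h e) - f x - h • Df(x) e`
    have hφh : φ h - φ 0 = (f (x + h • e) - f x) - h • fderiv ℝ f x e := by
      simp only [hφ, zero_smul, add_zero, sub_zero]
      abel
    rw [hφh, sub_zero] at hMVT
    have hkey : ‖h • fderiv ℝ f x e‖ ≤ 2 * δ₀ + K * h * h := by
      calc ‖h • fderiv ℝ f x e‖
          = ‖(f (x + h • e) - f x) - ((f (x + h • e) - f x) - h • fderiv ℝ f x e)‖ := by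
            rw [sub_sub_cancel]
        _ ≤ ‖f (x + h • e) - f x‖ + ‖(f (x + h • e) - f x) - h • fderiv ℝ f x e‖ := norm_sub_le _ _
        _ ≤ (‖f (x + h • e)‖ + ‖f x‖) + K * h * h := add_le_add (norm_sub_le _ _) hMVT
        _ ≤ (δ₀ + δ₀) + K * h * h := by gcongr <;> exact h0 _
        _ = 2 * δ₀ + K * h * h := by ring
    rw [norm_smul, Real.norm_of_nonneg hh.le] at hkey
    rw [div_add' _ _ _ hh.ne', le_div_iff₀ hh]
    calc ‖fderiv ℝ f x e‖ * h = h * ‖fderiv ℝ f x e‖ := mul_comm _ _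
      _ ≤ 2 * δ₀ + K * h * h := hkey
  exact ContinuousLinearMap.opNorm_le_of_unit_norm (by positivity) hunit

end Landau

end Literature.Analysis.FluidPDE

end
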